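import Mathlib
import HarnessLib
import Summits.Ventures.LatticeQCDFlow.Exactness.SphereFamilyLeapfrogHMCErgodic
import Summits.Ventures.LatticeQCDFlow.Exactness.CPNHeatBathErgodic

/-!
# The `cpn_2d` HMC (`HMCCPN.trajectory(τ, nstep = 1)`): exact, and uniformly ergodic to the lattice CP(N−1) law from every start

HONEST FRAMING: exact (Metropolis-corrected) sampling algorithms for lattice gauge theory;
figures of merit are autocorrelation/cost numbers at stated couplings and volumes; no
continuum-physics claim.

Venture `LatticeQCDFlow` (cell pub-lqcd), topic `Exactness`, FANOUT row 9 (eng-latcore, the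
engine `latflow.core.cpn_2d.HMCCPN`: `H = |π|²/2 + ω²/2 + S`, site momenta tangent to the site
spheres `S^{2N−1} ⊂ ℂ^N`, link momenta on the `U(1)` circles, ONE leapfrog step with the exact free
geodesic site update and the rotation of the link phases, Metropolis test, momenta forgotten).
NEW WORK of the cell — the CP(N−1) INSTANCE of parts 1–3 of the gen-16 chain
(`SphereFamilyLeapfrog.lean`, `SphereFamilyLeapfrogHMC.lean`, `SphereExpMapChart.lean`,
`SphereExpMapMinorisation.lean`, `SphereFamilyLeapfrogHMCErgodic.lean`) on the configuration space
of gen-12's `CPNHeatBathErgodic.lean` (`CPNConfig V E d = Π i : V ⊕ E, S^{cpnDim i + 1}`: sites on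
`S^{d+1} ⊂ ℝ^{d+2} = ℂ^N`, links on `S¹ ⊂ ℝ²`; `cpnAction` = the standard auxiliary-`U(1)` action;
`cpnGibbsLaw` = the finite-volume lattice CP(N−1) law).  Nothing is cited as a fact.  Printed
counterparts, NAMED ONLY: Duane–Kennedy–Pendleton–Roweth 1987; Engel–Schaefer, Comput. Phys.
Commun. 182 (2011) 2107, §2.2 (whose CP(N−1) HMC uses the quartic action without link variables —
the link circles here are the engine's auxiliary-field formulation, the `k = 0` members of the
family).

The dimension family is literally `cpnDim V E d` (`d` on sites, `0` on links), so
`FamS (cpnDim V E d) = CPNVar V E d` and the reference laws `uniformSphere` are `cpnRef V E d`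
definitionally: no transport is needed, only the identification of the two spellings of the Gibbs
law (`famGibbsLaw_cpnAction`).

## Content (force field `F` on the configuration space with values in the ambient momenta,
`F ω i ∈ ℝ^{cpnDim i + 2}` — in the engine the sphere-projected gradient `−∂S`, here ANY bounded
measurable field: its accuracy affects the acceptance, never exactness or the Doeblin bound)

* `exists_abs_cpnAction_le` — the action is bounded (continuous on a compact space);
  `famGibbsLaw_cpnAction` — `famGibbsLaw (cpnAction …) = cpnGibbsLaw …`.
* **`cpn_leapfrogHMC_invariant`** — EXACTNESS at every `nstep = n`, step `δ`, force `F`: the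
  kernel `famLeapfrogHMC F δ n hF (cpnAction …)` leaves `e^{−S} · ⊗ cpnRef` invariant.
* **`cpn_leapfrogHMC_uniformlyErgodic`** — at `nstep = 1`, `δ > 0`, `‖F ω i‖ ≤ b`: `∃ η ∈ (0, 1]`
  with `|μ₀Kᵗ(A) − cpnGibbsLaw(A)| ≤ (1 − η)ᵗ` for EVERY initial law `μ₀`, every `t`, every set
  `A`; `cpn_leapfrogHMC_uniformlyErgodic_of_continuous` — the same for any CONTINUOUS force field
  (bounded and measurable automatically; the engine's projected gradient is continuous).
* **`cpnGibbsLaw_unique_invariant_leapfrogHMC`** — the lattice CP(N−1) law is the ONLY invariant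
  probability law of the `nstep = 1` kernel.

NOT CLAIMED: `nstep ≥ 2` / `tau` splitting (exact by `cpn_leapfrogHMC_invariant`, ergodicity not
claimed — Mackenzie 1989); the Symanzik-improved action (continuous as well — the same theorems
apply verbatim to any continuous action, `famLeapfrogHMC_uniformlyErgodic`; not instantiated); that
the engine's force is `−∂S` projected (irrelevant here); any useful rate; floating point.
-/

noncomputable section

namespace Summit.Ventures.LatticeQCDFlow.Exactness

open MeasureTheory Measure Metric Set Real ProbabilityTheory
open scoped ENNReal InnerProductSpace

section CPN

variable {V E : Type*} [Fintype V] [Fintype E] {d : ℕ}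
  (src tgt : E → V) (J : EuclideanSpace ℝ (Fin (d + 2)) →L[ℝ] EuclideanSpace ℝ (Fin (d + 2))) (c : E → ℝ)

omit [Fintype V] in
/-- **The CP(N−1) action is bounded** (continuous on the compact configuration space). -/
theorem exists_abs_cpnAction_le : ∃ s : ℝ, ∀ ω : CPNConfig V E d, |cpnAction src tgt J c ω| ≤ s := by
  obtain ⟨s, hs⟩ := isCompact_univ.exists_bound_of_continuousOn
    (continuous_cpnAction src tgt J c).continuousOn
  exact ⟨s, fun ω => by simpa [Real.norm_eq_abs] using hs ω (mem_univ ω)⟩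

/-- **The two spellings of the lattice CP(N−1) law agree**: the Gibbs law of part 1b for the
dimension family `cpnDim V E d` and the action `cpnAction` IS gen-12's `cpnGibbsLaw`. -/
theorem famGibbsLaw_cpnAction :
    famGibbsLaw (k := cpnDim V E d) (cpnAction src tgt J c) = cpnGibbsLaw src tgt J c := by
  rw [famGibbsLaw, cpnGibbsLaw, piGibbsLaw, withDensity_apply _ MeasurableSet.univ, Measure.restrict_univ]
  rfl

variable {src tgt J c}

/-- **THE `cpn_2d` HMC IS EXACT** at every trajectory length `n`, step `δ` and for every measurable
force field: `e^{−S} · ⊗ cpnRef` is invariant. -/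
theorem cpn_leapfrogHMC_invariant {F : CPNConfig V E d → (Π i, FamE (cpnDim V E d) i)}
    (hF : Measurable F) (δ : ℝ) (n : ℕ) :
    Kernel.Invariant (famLeapfrogHMC (k := cpnDim V E d) F δ n hF (cpnAction src tgt J c))
      ((Measure.pi (cpnRef V E d)).withDensity (gibbsDensity (cpnAction src tgt J c))) :=
  famLeapfrogHMC_invariant hF δ n (continuous_cpnAction src tgt J c).measurable

/-- **THE `cpn_2d` HMC AT `nstep = 1` CONVERGES TO THE LATTICE CP(N−1) LAW FROM EVERY START.**  For
every step `δ > 0` and every measurable force field with `‖F ω i‖ ≤ b`: there is `η ∈ (0, 1]` with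
`|μ₀Kᵗ(A) − cpnGibbsLaw(A)| ≤ (1 − η)ᵗ` for every initial law `μ₀`, every `t`, every set `A`. -/
theorem cpn_leapfrogHMC_uniformlyErgodic {F : CPNConfig V E d → (Π i, FamE (cpnDim V E d) i)}
    (hF : Measurable F) {δ : ℝ} (hδ : 0 < δ) {b : ℝ} (hb0 : 0 ≤ b) (hb : ∀ ω i, ‖F ω i‖ ≤ b) :
    ∃ η : ℝ, 0 < η ∧ η ≤ 1 ∧ ∀ (μ₀ : Measure (CPNConfig V E d)) [IsProbabilityMeasure μ₀] (t : ℕ)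
      (A : Set (CPNConfig V E d)),
      |((fun m : Measure (CPNConfig V E d) =>
          m.bind (famLeapfrogHMC (k := cpnDim V E d) F δ 1 hF (cpnAction src tgt J c)))^[t] μ₀).real A
          - (cpnGibbsLaw src tgt J c).real A| ≤ (1 - η) ^ t := by
  obtain ⟨s, hs⟩ := exists_abs_cpnAction_le src tgt J c
  rw [← famGibbsLaw_cpnAction]
  exact famLeapfrogHMC_uniformlyErgodic hδ hF hb0 hb (continuous_cpnAction src tgt J c).measurable hs

/-- … in particular for every CONTINUOUS force field (bounded on the compact configuration space and
measurable — the engine's sphere-projected gradient of `βS` is continuous). -/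
theorem cpn_leapfrogHMC_uniformlyErgodic_of_continuous {F : CPNConfig V E d → (Π i, FamE (cpnDim V E d) i)}
    (hF : Continuous F) {δ : ℝ} (hδ : 0 < δ) :
    ∃ η : ℝ, 0 < η ∧ η ≤ 1 ∧ ∀ (μ₀ : Measure (CPNConfig V E d)) [IsProbabilityMeasure μ₀] (t : ℕ)
      (A : Set (CPNConfig V E d)),
      |((fun m : Measure (CPNConfig V E d) =>
          m.bind (famLeapfrogHMC (k := cpnDim V E d) F δ 1 hF.measurable (cpnAction src tgt J c)))^[t] μ₀).real A
          - (cpnGibbsLaw src tgt J c).real A| ≤ (1 - η) ^ t := by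
  obtain ⟨b, hb⟩ := isCompact_univ.exists_bound_of_continuousOn hF.continuousOn
  have hb0 : 0 ≤ b := (norm_nonneg _).trans (hb (fun i => sphereDefault) (mem_univ _))
  refine cpn_leapfrogHMC_uniformlyErgodic hF.measurable hδ hb0 fun ω i => ?_
  exact (norm_le_pi_norm (F ω) i).trans (hb ω (mem_univ ω))

/-- **THE LATTICE CP(N−1) LAW IS THE UNIQUE INVARIANT PROBABILITY LAW of the `nstep = 1` `cpn_2d`
HMC** (any `δ > 0`, any bounded measurable force field). -/
theorem cpnGibbsLaw_unique_invariant_leapfrogHMC {F : CPNConfig V E d → (Π i, FamE (cpnDim V E d) i)}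
    (hF : Measurable F) {δ : ℝ} (hδ : 0 < δ) {b : ℝ} (hb0 : 0 ≤ b) (hb : ∀ ω i, ‖F ω i‖ ≤ b)
    {π' : Measure (CPNConfig V E d)} [IsProbabilityMeasure π']
    (hπ' : Kernel.Invariant (famLeapfrogHMC (k := cpnDim V E d) F δ 1 hF (cpnAction src tgt J c)) π') :
    π' = cpnGibbsLaw src tgt J c := by
  obtain ⟨s, hs⟩ := exists_abs_cpnAction_le src tgt J c
  rw [← famGibbsLaw_cpnAction]
  exact famLeapfrogHMC_invariant_unique hδ hF hb0 hb (continuous_cpnAction src tgt J c).measurable hs hπ'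

end CPN

end Summit.Ventures.LatticeQCDFlow.Exactness

end
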